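import Mathlib
import HarnessLib
import Literature.MathematicalPhysics.QuantumFieldTheory.Balaban1983to89.TorusGeometry
import Literature.MathematicalPhysics.QuantumFieldTheory.Balaban1983to89.B10SectAGathering

/-!
# `Balaban1983to89.B10StarCount` — [Balaban1985UV3] p. 260, the bond count **|Ω₁*|** of (18)/(22)/(36)/(51)/(55)/(62),
# and the UNPRINTED two-sided count behind p. 265 *"We have to supplement also the constants in (22), involving
# log σ₀ and log g₀, to the whole lattice"* / p. 271 *"Complementing the constants in (55) to the full lattice T^{(k)}"*
# (the leaf `B10SectAGathering.StarCount`), PROVED on the carrier of record `…Setup` / `…TorusGeometry`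

T. Bałaban, *Ultraviolet stability of three-dimensional lattice pure gauge field theories*, Commun. Math. Phys. **102**,
255–275 (1985) [Balaban1985UV3] (cell paper B10; held `paper:balaban1985-cmp102-uv-stability-3d`; journal page =
PDF page + 254).  The quotations below were READ AS IMAGES on the renders
`run/shared/lean/pub/pub-balaban/b2b-balaban-ref1/pages/1985-cmp102-uv-stability-3d/…-p004-x2.png` (p. 258),
`…-p006-x2.png` (p. 260), `…-p007-x2.png` (p. 261), `…-p011-x2.png` (p. 265), `…-p014-x2.png` (p. 268),
`…-p017-x2.png` (p. 271), 2026-08-21.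

HONEST FRAMING (mega-formalization `lit-balaban`, verbatim): statement-level skeleton of published theorems with
citation tags; proofs where landed; nothing here is a claim about the Yang–Mills mass gap.

WHAT IS PRINTED (verbatim).
* p. 258, (9): *"We remove this freedom in the domain Ω₁ by a simple Faddeev-Popov procedure, using the identity
  Π_{y∈Ω₁^{(1)}} ∫ Π_{x∈B(y),x≠y} du(x) δ_{Ax(y)}(U^u) = 1,  (9)"* — the axial gauge fixing set of a block `B(y)` has one
  condition per site `x ∈ B(y)`, `x ≠ y` (on `…Setup`: `AxialGauge cd U := ∀ y x, blockOf x = y → x ≠ emb y →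
  cd.holTo U y x = 1`, `gaugeFixFn cd Y U = Σ_{y∈Y} Σ_{x∈B(y)∖{y}} …`).
* p. 260, after (18): *"… − E + log σ₀|Ω₁*|], (18) where χ = Π_{b∈Ω₁} χ({|A(b)| < g₀p²(g₀)}), g₀ sufficiently small, and
  |Ω₁*| denotes the number of bonds belonging to Ω₁ minus the number of bonds in Ω₁^{(1)} and minus the number of
  bonds in the axial gauge fixing set."*
* p. 261, (22): *"… − E + log σ₀|Ω₁*| + d(𝔤)log g₀|Ω₁*|] …, where χ = Π_{b∈Ω₁} χ({|A(b)| < p²(g₀)}), and d(𝔤) denotes a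
  dimension of the Lie algebra 𝔤."*
* p. 265: *"We have to supplement also the constants in (22), involving log σ₀ and log g₀, to the whole lattice."*;
  (36) carries *"+ O(log g₀⁻¹)|Ω₁ᶜ|"* and *"E^{(0)} = log σ₀|T₁*| + d(𝔤)log g₀|T₁*| + log Z^{(0)}(T₁, 1) + Σ_X 𝒫′₁(g₀, X, 1)."*
* p. 268: *"We change the definition of Λ_k, taking Λ_k = Ω_k^{(k)}∖Ω_{k+1}^{(k)}, and we define Λ_{k+1} = Ω_{k+1}^{(k+1)},
  hence Ω_{k+1}^{(k)} = B(Λ_{k+1})."*, *"The first is simply the integral restricted to Z_k = B(Λ_{k+1})ᶜ"*, and after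
  (51): *"|B(Λ_{k+1})*| has the same meaning as |Ω₁*| in the first step."*
* p. 271: *"Complementing the constants in (55) to the full lattice T^{(k)}, and gathering together all the
  transformations and estimates, we obtain the inductive inequality (41) for k replaced by k + 1"*;
  (62) *"E^{(k)} = log σ₀|T₁^{(k)*}| + d(𝔤)log g_k|T₁^{(k)*}| + log Z^{(k)}(T₁^{(k)}, 1) + Σ_X 𝒫′_{k+1}(g_k, X, 1)."*

WHY THIS FILE EXISTS (unit `lit-balaban-r07`, reader/typer and fold owner of B10, gen 8).  Passing from the
`B(Λ_{k+1})`-constants `(log σ₀ + d(𝔤)log g_k)|B(Λ_{k+1})*|` of (22)/(55) to the full-lattice `E^{(k)}` of (36)/(62)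
needs a COUNT the paper does not print: `0 ≤ |T₁^{(k)*}| − |B(Λ_{k+1})*| ≤ c₁|Z_k|`.  The cell `pub-balaban` typed it as
the LEAF `B10SectAGathering.StarCount P c₁` over abstract reals (cell GAPS G-B10-07 (a), G-B10-13 (b); the kernel
certificate C-b10g6-1 lists *"the star-bond count"* among the items NOT certified), consumed by
`B10SectAGathering.constants_complement` — the place where the printed `O(log g_k⁻¹)|Z_k|` of (36)/(41) is born.  This
file DEFINES |X*| exactly as printed for a union of blocks `X = B(Λ)`, `Λ ⊂ T^{(j+1)}`, on the lattice carrier of record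
(`…Setup`: `Site P j`, `PBond P j`, `blockOf`, `block`, `emb`; `…TorusGeometry`: `Site.blockSite`, `Site.blockEquiv`,
`Site.card_block`), and PROVES: the exact whole-lattice value, the deficit identity, the two-sided bound with an
explicit `c₁`, and the leaf `StarCount` BY NAME for any step pieces whose three counts are these.

DICTIONARY print ↦ Lean.  The unit lattice `T₁^{(k)}` of step k ↦ `Site P j` (any level `j` in the standing range
`j + 1 ≤ m + K` of `…Setup`; the count is scale-free); `T^{(k+1)}` ↦ `Site P (j+1)`; `Λ_{k+1}` (k = 0: `Ω₁^{(1)}`) ↦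
`Λ : Finset (Site P (j+1))`; `B(Λ)` ↦ `blockSet Λ`; *"bonds belonging to"* a set of sites ↦ `bondsIn` (positively
oriented bonds `⟨x, x + e_μ⟩` with both endpoints in the set); *"bonds in Ω₁^{(1)}"* ↦ `bondsIn Λ` on `PBond P (j+1)`;
*"the axial gauge fixing set"* ↦ the pairs `(y, x)`, `y ∈ Λ`, `x ∈ B(y)∖{y}` of (9), counted by `axialCount`;
`|B(Λ)*|` ↦ `starCount Λ : ℤ`; `Z_k = B(Λ_{k+1})ᶜ` ↦ `(blockSet Λ)ᶜ` (its number of sites is the `Zvol` of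
`B10SectAGathering.StepPieces`).

WHAT THIS FILE PROVES (kernel, no `sorry`, axioms standard; six counting definitions (`bondsIn`, `blockSet`, `axialCount`,
`starCount`, `outCount`, `cStar`) and one `Equiv` (`shiftEquiv`), theorems otherwise; NO `Prop`-valued definition, NO new
named fact).
§1 definitions `bondsIn`, `blockSet`, `axialCount`, `starCount`, `outCount`, `cStar` (+ membership lemmas).
§2 lattice geometry on `…Setup`: `blockOf_shift` (the block of `x + e_μ` is `blockOf x`, or `blockOf x + e_μ` exactly on
   the top layer of the block), `sum_block` (a block is parametrised by the offsets `{0,…,L−1}^d`),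
   `card_block_filter_top` (the top layer of a block in direction `μ` has `L^{d−1}` sites), `card_blockSet`
   (`|B(Λ)| = L^d|Λ|`), `card_compl_blockSet` (`|Z| = L^d|Λᶜ|`).
§3 the counts: `axialCount_eq` (`= (L^d − 1)|Λ|`), `card_bondsIn_univ` (`= d·|T|`), `card_bondsIn_blockSet`
   (`#bonds(B(Λ)) = d(L^d − L^{d−1})|Λ| + L^{d−1}·#bonds(Λ)`), `card_bondsIn_add` (`#bonds(Λ) + #out(Λ) + d|Λᶜ| = d|T^{(j+1)}|`),
   `outCount_le` (`#out(Λ) ≤ d|Λᶜ|`).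
§4 THE STAR COUNT: `starCount_univ` — **`|T₁^{(k)*}| = (d − 1)(L^d − 1)|T^{(k+1)}|`**, equivalently
   `L^d|T₁^{(k)*}| = (d − 1)(L^d − 1)|T₁^{(k)}|` (`starCount_univ_fine`); `starCount_nonneg` (|X*| is a genuine count);
   `starCount_deficit_eq` — **`|T*| − |B(Λ)*| = (d − 1)(L^d − 1)|Λᶜ| + (L^{d−1} − 1)·#out(Λ)`**; hence
   `starCount_deficit_nonneg`, `starCount_le_univ` and `starCount_deficit_le` — **`0 ≤ |T*| − |B(Λ)*| ≤ c⋆|Λᶜ| = (c⋆/L^d)|Z|`**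
   with `c⋆ = (d − 1)(L^d − 1) + d(L^{d−1} − 1)` (`cStar`; real form `starCount_deficit_le_real`).
§5 the leaf BY NAME: `starCount_leaf` — for every `S : B10SectAGathering.StepPieces T k` whose `starT`, `starB h`,
   `Zvol h` are `starCount univ`, `starCount (Λ h)`, `|(blockSet (Λ h))ᶜ|` for some assignment `h ↦ Λ h` of coarse
   regions to histories, `B10SectAGathering.StarCount S (c⋆/L^d)` HOLDS; and `constants_complement_concrete` = the cell's
   `constants_complement` with that input discharged.
§6 d = 3 (the paper's case, Theorem 1 p. 257): `cStar_d3` (`c⋆ = 2L³ + 3L² − 5`), `cStar_div_lt_three` (`c⋆/L³ < 3`),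
   `starCount_univ_d3` (`|T₁^{(k)*}| = 2(L³ − 1)|T^{(k+1)}|`, i.e. `2(1 − L⁻³)|T₁^{(k)}|`).

SCOPE, stated honestly.  Bonds are indexed by (initial point, direction), as everywhere on `…Setup` (the series' tori
have `2L^{m+K−j} ≥ 2` sites per direction, so `y + e_μ ≠ y`, but nothing below needs it).  The axial set is counted as
in (9) — one condition per `x ∈ B(y)∖{y}` — which is the number of bonds of any spanning tree of `B(y)`; the contours
`Γ_{y,x}` themselves are not modelled on `…Setup` (cell DIVERGENCE F6).  The sibling `…B16TstarCount` (cell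
`pub-balaban`) treats the DIFFERENT convention of [Balaban1988Convergent] (1.15) (`|Ω₁*|` = bonds minus `{b₀(c)}`, no
axial term; whole lattice only) on its own lattice model; nothing of it is re-declared or used here.  Value = the
unprinted count behind two printed sentences, with explicit constants, meeting the cell's leaf by name; NOT summit
progress.
-/

namespace Literature.MathematicalPhysics.QuantumFieldTheory.Balaban1983to89.B10StarCount

open Finset
open Literature.MathematicalPhysics.QuantumFieldTheory.Balaban1983to89

variable {P : Params} {j : ℕ}

/-! ## §1 The printed objects -/

/-- *"the number of bonds belonging to"* a set `X` of sites (p. 260): the positively oriented bonds `⟨x, x + e_μ⟩`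
with both endpoints in `X`. [cite: Balaban1985UV3, p.260 (after (18))] -/
def bondsIn {i : ℕ} (X : Finset (Site P i)) : Finset (PBond P i) :=
  univ.filter (fun b => b.src ∈ X ∧ b.tgt ∈ X)

/-- `B(Λ) = ⋃_{y∈Λ} B(y)` — p. 268 *"Ω_{k+1}^{(k)} = B(Λ_{k+1})"*, a union of blocks of the unit lattice. [cite: Balaban1985UV3, p.268] -/
def blockSet (Λ : Finset (Site P (j + 1))) : Finset (Site P j) :=
  univ.filter (fun x => blockOf x ∈ Λ)

/-- *"the number of bonds in the axial gauge fixing set"* of `B(Λ)` (p. 260): by (9) p. 258 the axial gauge of a block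
`B(y)` is fixed by one condition per site `x ∈ B(y)`, `x ≠ y` (`…Setup.AxialGauge`), i.e. `Σ_{y∈Λ} |B(y)∖{y}|`.
[cite: Balaban1985UV3, (9) p.258] -/
def axialCount (Λ : Finset (Site P (j + 1))) : ℕ :=
  ∑ y ∈ Λ, ((block y).erase (emb y)).card

/-- **`|B(Λ)*|`** (p. 260, p. 268): *"the number of bonds belonging to Ω₁ minus the number of bonds in Ω₁^{(1)} and minus
the number of bonds in the axial gauge fixing set"*, for `Ω₁ = B(Λ)`, `Ω₁^{(1)} = Λ`. [cite: Balaban1985UV3, p.260 (after (18))] -/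
def starCount (Λ : Finset (Site P (j + 1))) : ℤ :=
  ((bondsIn (blockSet Λ)).card : ℤ) - ((bondsIn Λ).card : ℤ) - (axialCount Λ : ℤ)

/-- The number of coarse bonds LEAVING `Λ` (`c₋ ∈ Λ`, `c₊ ∉ Λ`) — the boundary term of the deficit identity. [folklore] -/
def outCount {i : ℕ} (Λ : Finset (Site P i)) : ℕ :=
  (univ.filter (fun c : PBond P i => c.src ∈ Λ ∧ c.tgt ∉ Λ)).card

/-- The constant `c⋆ = (d − 1)(L^d − 1) + d(L^{d−1} − 1) = (d − 1)L^d + dL^{d−1} − 2d + 1` of the deficit bound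
(per coarse site of the complement; per unit-lattice site of `Z_k` it is `c⋆/L^d`). [folklore] -/
noncomputable def cStar (P : Params) : ℝ :=
  ((P.d : ℝ) - 1) * ((P.L : ℝ) ^ P.d - 1) + (P.d : ℝ) * ((P.L : ℝ) ^ (P.d - 1) - 1)

/-- Membership in `bondsIn` (unfolding of the printed *"bonds belonging to"*). [cite: Balaban1985UV3, p.260 (after (18))] -/
theorem mem_bondsIn {i : ℕ} (X : Finset (Site P i)) (b : PBond P i) :
    b ∈ bondsIn X ↔ b.src ∈ X ∧ b.tgt ∈ X := by
  simp [bondsIn]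

/-- Membership in `B(Λ)`. [cite: Balaban1985UV3, p.268] -/
theorem mem_blockSet (Λ : Finset (Site P (j + 1))) (x : Site P j) : x ∈ blockSet Λ ↔ blockOf x ∈ Λ := by
  simp [blockSet]

/-- `B(T^{(j+1)}) = T^{(j)}` (the blocks cover the fine lattice). [cite: Balaban1985UV3, p.268] -/
theorem blockSet_univ : blockSet (univ : Finset (Site P (j + 1))) = (univ : Finset (Site P j)) := by
  ext x; simp [blockSet]

/-- `B(Λ)ᶜ = B(Λᶜ)` (the blocks partition the fine lattice): `Z_k = B(Λ_{k+1})ᶜ` is itself a union of blocks. [cite: Balaban1985UV3, p.268] -/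
theorem compl_blockSet (Λ : Finset (Site P (j + 1))) : (blockSet Λ)ᶜ = blockSet Λᶜ := by
  ext x; simp [blockSet]

/-! ## §2 Lattice geometry on `…Setup`: shifts and blocks -/

section Geometry

/-- `(x + e_μ)_μ = x_μ + 1` (elementary bookkeeping on the torus sites of `…Setup`; serves the count of
[Balaban1985UV3] p. 260). [cite: Balaban1987RG1, (0.1) p.251] -/
@[simp] theorem shift_apply_self {i : ℕ} (x : Site P i) (μ : Fin P.d) : x.shift μ μ = x μ + 1 := by
  simp [Site.shift]

/-- `(x + e_μ)_ν = x_ν` for `ν ≠ μ` (elementary; torus sites of `…Setup`). [cite: Balaban1987RG1, (0.1) p.251] -/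
theorem shift_apply_ne {i : ℕ} (x : Site P i) {μ ν : Fin P.d} (h : ν ≠ μ) : x.shift μ ν = x ν := by
  simp [Site.shift, Function.update_of_ne h]

/-- `(x − e_μ) + e_μ = x` (elementary; torus sites of `…Setup`). [cite: Balaban1987RG1, (0.1) p.251] -/
theorem shift_unshift {i : ℕ} (x : Site P i) (μ : Fin P.d) : (x.unshift μ).shift μ = x := by
  funext ν
  by_cases h : ν = μ
  · subst h; simp [Site.shift, Site.unshift]
  · simp [Site.shift, Site.unshift, Function.update_of_ne h]

/-- `(x + e_μ) − e_μ = x` (elementary; torus sites of `…Setup`). [cite: Balaban1987RG1, (0.1) p.251] -/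
theorem unshift_shift {i : ℕ} (x : Site P i) (μ : Fin P.d) : (x.shift μ).unshift μ = x := by
  funext ν
  by_cases h : ν = μ
  · subst h; simp [Site.shift, Site.unshift]
  · simp [Site.shift, Site.unshift, Function.update_of_ne h]

/-- Translation by `e_μ` is a bijection of the torus. [folklore] -/
def shiftEquiv {i : ℕ} (μ : Fin P.d) : Site P i ≃ Site P i where
  toFun x := x.shift μ
  invFun x := x.unshift μ
  left_inv x := unshift_shift x μ
  right_inv x := shift_unshift x μ

/-- A sum over bonds is a double sum over initial points and directions (elementary; the positively oriented bonds
`⟨x, x + e_μ⟩` of `…Setup`, B7 (5); serves the count of [Balaban1985UV3] p. 260). [cite: Balaban1985Averaging, (5) p.18] -/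
theorem sum_pbond {i : ℕ} {M : Type*} [AddCommMonoid M] (F : PBond P i → M) :
    ∑ b : PBond P i, F b = ∑ x : Site P i, ∑ μ : Fin P.d, F ⟨x, μ⟩ := by
  rw [← Fintype.sum_prod_type (f := fun p : Site P i × Fin P.d => F ⟨p.1, p.2⟩)]
  exact Fintype.sum_equiv ⟨fun b => (b.src, b.dir), fun p => ⟨p.1, p.2⟩, fun _ => rfl, fun _ => rfl⟩ _ _
    (fun _ => rfl)

/-- The number of positively oriented bonds of `T^{(i)}` is `d·|T^{(i)}|` (elementary; bonds of `…Setup`, B7 (5)). [cite: Balaban1985Averaging, (5) p.18] -/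
theorem card_pbond {i : ℕ} : Fintype.card (PBond P i) = P.d * Fintype.card (Site P i) := by
  rw [Fintype.ofEquiv_card, Fintype.card_prod, Fintype.card_fin, mul_comm]

/-- **The block of a shifted site.**  In the standing range `j + 1 ≤ m + K` (so that a block is `L` consecutive labels
per direction): `blockOf (x + e_μ) = blockOf x` unless `x` lies on the top layer of its block in direction `μ`
(label `≡ L − 1 (mod L)`), in which case `blockOf (x + e_μ) = blockOf x + e_μ` (including the wrap-around of the
torus, where both sides wrap together since `|T^{(j)}| = L·|T^{(j+1)}|` per direction).  Elementary lattice geometry of the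
blocks (0.3) [I] as typed on `…Setup` (`blockOf` = integer division of the labels by `L`); serves the count of
[Balaban1985UV3] p. 260. [cite: Balaban1987RG1, (0.3) p.252] -/
theorem blockOf_shift (hj : j + 1 ≤ P.m + P.K) (x : Site P j) (μ : Fin P.d) :
    blockOf (x.shift μ) = if (x μ).val % P.L + 1 = P.L then (blockOf x).shift μ else blockOf x := by
  have hL : 0 < P.L := P.L_pos
  have hL1 : 1 < P.L := P.hL.2
  have hN : P.sitesPerDir j = P.sitesPerDir (j + 1) * P.L := P.sitesPerDir_eq_mul_succ hj
  set v : ℕ := (x μ).val with hv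
  have hvlt : v < P.sitesPerDir j := ZMod.val_lt _
  have hval : ((x.shift μ) μ).val = (v + 1) % P.sitesPerDir j := by
    rw [shift_apply_self, ZMod.val_add, ZMod.val_one]
  have hdm : P.L * (v / P.L) + v % P.L = v := Nat.div_add_mod v P.L
  have hmodlt : v % P.L < P.L := Nat.mod_lt _ hL
  funext ν
  by_cases hν : ν = μ
  · subst hν
    split_ifs with h
    · -- top layer: `v + 1 = L·(v/L + 1)`
      have hsucc : v + 1 = P.L * (v / P.L + 1) := by rw [mul_add, mul_one]; omega
      have hmod : (v + 1) % P.sitesPerDir j = P.L * ((v / P.L + 1) % P.sitesPerDir (j + 1)) := by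
        rw [hN, mul_comm (P.sitesPerDir (j + 1)) P.L, hsucc, Nat.mul_mod_mul_left]
      show (((((x.shift ν) ν).val / P.L : ℕ)) : ZMod (P.sitesPerDir (j + 1))) = ((blockOf x).shift ν) ν
      rw [hval, hmod, Nat.mul_div_cancel_left _ hL, ZMod.natCast_mod, shift_apply_self]
      simp [blockOf, hv]
    · -- interior: no carry
      have hlt : v % P.L + 1 < P.L := lt_of_le_of_ne (by omega) h
      have hndvd : ¬ P.L ∣ v + 1 := by
        intro hd
        have h0 : (v + 1) % P.L = 0 := Nat.mod_eq_zero_of_dvd hd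
        have h1 : (v + 1) % P.L = v % P.L + 1 := by
          rw [Nat.add_mod, Nat.mod_eq_of_lt hL1, Nat.mod_eq_of_lt hlt]
        omega
      have hvs : v + 1 < P.sitesPerDir j := by
        rcases Nat.lt_or_ge (v + 1) (P.sitesPerDir j) with h' | h'
        · exact h'
        · exfalso
          have : v + 1 = P.sitesPerDir j := le_antisymm hvlt h'
          exact hndvd ⟨P.sitesPerDir (j + 1), by rw [this, hN, mul_comm]⟩
      show (((((x.shift ν) ν).val / P.L : ℕ)) : ZMod (P.sitesPerDir (j + 1))) = (blockOf x) ν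
      rw [hval, Nat.mod_eq_of_lt hvs, Nat.succ_div_of_not_dvd hndvd]
      simp [blockOf, hv]
  · have h1 : (x.shift μ) ν = x ν := shift_apply_ne x hν
    split_ifs with h
    · show _ = ((blockOf x).shift μ) ν
      rw [shift_apply_ne _ hν]
      simp [blockOf, h1]
    · simp [blockOf, h1]

/-- `blockSite y` (the site of `B(y)` with offset `r ∈ {0,…,L−1}^d`) is injective. [folklore] -/
private theorem blockSite_injective (hj : j + 1 ≤ P.m + P.K) (y : Site P (j + 1)) :
    Function.Injective (Site.blockSite y : (Fin P.d → Fin P.L) → Site P j) := by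
  intro r r' h
  have : (Site.blockEquiv hj y).symm r = (Site.blockEquiv hj y).symm r' := Subtype.ext h
  exact (Site.blockEquiv hj y).symm.injective this

/-- `B(y)` is the image of the offsets `{0,…,L−1}^d` under `blockSite y`. [folklore] -/
private theorem block_eq_image (hj : j + 1 ≤ P.m + P.K) (y : Site P (j + 1)) :
    block y = univ.image (Site.blockSite y) := by
  ext x
  simp only [block, mem_filter, mem_univ, true_and, mem_image]
  constructor
  · intro hx
    refine ⟨Site.blockEquiv hj y ⟨x, hx⟩, ?_⟩
    have := (Site.blockEquiv hj y).symm_apply_apply ⟨x, hx⟩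
    exact congrArg Subtype.val this
  · rintro ⟨r, rfl⟩
    exact Site.blockOf_blockSite hj y r

/-- A sum over a block `B(y)` is a sum over the offsets `{0,…,L−1}^d` (elementary; (0.3) [I]: `B(y)` = *"the L^{kd}
points"*, k = 1, as parametrised by `Site.blockEquiv` of `…TorusGeometry`). [cite: Balaban1987RG1, (0.3) p.252] -/
theorem sum_block (hj : j + 1 ≤ P.m + P.K) (y : Site P (j + 1)) {M : Type*} [AddCommMonoid M]
    (f : Site P j → M) : ∑ x ∈ block y, f x = ∑ r : Fin P.d → Fin P.L, f (Site.blockSite y r) := by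
  rw [block_eq_image hj, sum_image (fun r _ r' _ h => blockSite_injective hj y h)]

/-- The label of `blockSite y r` modulo `L` is the offset `r`. [folklore] -/
private theorem val_blockSite_mod (hj : j + 1 ≤ P.m + P.K) (y : Site P (j + 1)) (r : Fin P.d → Fin P.L) (μ : Fin P.d) :
    ((Site.blockSite y r) μ).val % P.L = r μ := by
  rw [Site.val_blockSite hj, Nat.mul_add_mod', Nat.mod_eq_of_lt (r μ).isLt]

/-- **The top layer of a block in direction `μ` has `L^{d−1}` sites** (elementary geometry of the blocks (0.3) [I] on
`…Setup`; serves the count of [Balaban1985UV3] p. 260). [cite: Balaban1987RG1, (0.3) p.252] -/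
theorem card_block_filter_top (hj : j + 1 ≤ P.m + P.K) (y : Site P (j + 1)) (μ : Fin P.d) :
    ((block y).filter (fun x => (x μ).val % P.L + 1 = P.L)).card = P.L ^ (P.d - 1) := by
  have hL : 0 < P.L := P.L_pos
  let top : Fin P.L := ⟨P.L - 1, Nat.sub_lt hL Nat.one_pos⟩
  rw [card_filter, sum_block hj]
  have hiff : ∀ r : Fin P.d → Fin P.L,
      (((Site.blockSite y r) μ).val % P.L + 1 = P.L) ↔ r μ = top := by
    intro r
    rw [val_blockSite_mod hj, Fin.ext_iff]
    show (r μ : ℕ) + 1 = P.L ↔ (r μ : ℕ) = P.L - 1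
    omega
  simp_rw [hiff]
  rw [← card_filter]
  have h := Fintype.card_filter_piFinset_const_eq_of_mem (univ : Finset (Fin P.L)) μ (mem_univ top)
  rw [Fintype.piFinset_univ, card_univ, Fintype.card_fin, Fintype.card_fin] at h
  exact h

/-- The complementary count: `L^d − L^{d−1}` sites of a block are NOT on the top layer in direction `μ` (elementary;
blocks (0.3) [I] on `…Setup`). [cite: Balaban1987RG1, (0.3) p.252] -/
theorem card_block_filter_not_top (hj : j + 1 ≤ P.m + P.K) (y : Site P (j + 1)) (μ : Fin P.d) :
    ((block y).filter (fun x => ¬ ((x μ).val % P.L + 1 = P.L))).card = P.L ^ P.d - P.L ^ (P.d - 1) := by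
  have h := card_filter_add_card_filter_not (s := block y) (fun x => (x μ).val % P.L + 1 = P.L)
  rw [card_block_filter_top hj, Site.card_block hj] at h
  omega

/-- `|B(Λ)| = L^d·|Λ|`. [cite: Balaban1985UV3, p.268] -/
theorem card_blockSet (hj : j + 1 ≤ P.m + P.K) (Λ : Finset (Site P (j + 1))) :
    (blockSet Λ).card = P.L ^ P.d * Λ.card := by
  have : blockSet Λ = Λ.biUnion block := by
    ext x; simp [blockSet, block]
  rw [this, card_biUnion]
  · simp [Site.card_block hj, mul_comm]
  · intro y _ y' _ hne
    simp only [Function.onFun, block]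
    exact disjoint_filter.2 (fun x _ hx hx' => hne (hx.symm.trans hx'))

/-- `|Z_k| = |B(Λ_{k+1})ᶜ| = L^d·|Λ_{k+1}ᶜ|` unit-lattice sites. [cite: Balaban1985UV3, p.268] -/
theorem card_compl_blockSet (hj : j + 1 ≤ P.m + P.K) (Λ : Finset (Site P (j + 1))) :
    ((blockSet Λ)ᶜ).card = P.L ^ P.d * (Λᶜ).card := by
  rw [compl_blockSet, card_blockSet hj]

end Geometry

/-! ## §3 The three counts -/

section Counts

/-- **The axial count**: `(L^d − 1)` conditions per block, `|Ax(B(Λ))| = (L^d − 1)|Λ|` ((9): `x ∈ B(y)`, `x ≠ y`;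
`|B(y)| = L^d`, `y ∈ B(y)`). [cite: Balaban1985UV3, (9) p.258] -/
theorem axialCount_eq (hj : j + 1 ≤ P.m + P.K) (Λ : Finset (Site P (j + 1))) :
    axialCount Λ = (P.L ^ P.d - 1) * Λ.card := by
  unfold axialCount
  have : ∀ y ∈ Λ, ((block y).erase (emb y)).card = P.L ^ P.d - 1 := by
    intro y _
    rw [card_erase_of_mem (Site.emb_mem_block hj y), Site.card_block hj]
  rw [sum_congr rfl this, sum_const, smul_eq_mul, mul_comm]

/-- The printed *"number of bonds belonging to"* a set, as a double sum of indicators (`b₊ = b₋ + e_μ`; elementary).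
[cite: Balaban1985UV3, p.260 (after (18))] -/
theorem card_bondsIn_eq_sum {i : ℕ} (X : Finset (Site P i)) :
    (bondsIn X).card = ∑ x : Site P i, ∑ μ : Fin P.d, if x ∈ X ∧ x.shift μ ∈ X then 1 else 0 := by
  rw [bondsIn, card_filter, sum_pbond]
  rfl

/-- All bonds belong to the whole lattice: `#bonds(T^{(i)}) = d·|T^{(i)}|` (elementary; serves `|T₁^{(k)*}|` of (62)).
[cite: Balaban1985UV3, p.260 (after (18)), (62) p.271] -/
theorem card_bondsIn_univ {i : ℕ} : (bondsIn (univ : Finset (Site P i))).card = P.d * Fintype.card (Site P i) := by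
  have : bondsIn (univ : Finset (Site P i)) = univ := by ext b; simp [bondsIn]
  rw [this, card_univ, card_pbond]

/-- **Bonds belonging to a union of blocks**: `#bonds(B(Λ)) = d(L^d − L^{d−1})|Λ| + L^{d−1}·#bonds(Λ)` — inside each
block `L^d − L^{d−1}` bonds per direction stay in the block, and the `L^{d−1}` bonds leaving through the top layer land
in `B(y + e_μ)`, which lies in `B(Λ)` iff the coarse bond `⟨y, y + e_μ⟩` belongs to `Λ` (elementary; the first of
the three numbers of the printed `|Ω₁*|` for `Ω₁ = B(Λ)`). [cite: Balaban1985UV3, p.260 (after (18))] -/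
theorem card_bondsIn_blockSet (hj : j + 1 ≤ P.m + P.K) (Λ : Finset (Site P (j + 1))) :
    (bondsIn (blockSet Λ)).card
      = P.d * (P.L ^ P.d - P.L ^ (P.d - 1)) * Λ.card + P.L ^ (P.d - 1) * (bondsIn Λ).card := by
  classical
  -- the summand, per fine site and direction
  set F : Site P j → ℕ := fun x => ∑ μ : Fin P.d, if blockOf x ∈ Λ ∧ blockOf (x.shift μ) ∈ Λ then 1 else 0 with hF
  have h1 : (bondsIn (blockSet Λ)).card = ∑ x : Site P j, F x := by
    rw [card_bondsIn_eq_sum]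
    simp only [hF, mem_blockSet]
  -- per block
  have hblock : ∀ y : Site P (j + 1), ∑ x ∈ block y, F x
      = if y ∈ Λ then ∑ μ : Fin P.d, ((P.L ^ P.d - P.L ^ (P.d - 1)) + P.L ^ (P.d - 1) *
          (if y.shift μ ∈ Λ then 1 else 0)) else 0 := by
    intro y
    by_cases hy : y ∈ Λ
    · rw [if_pos hy, hF, sum_comm]
      refine sum_congr rfl (fun μ _ => ?_)
      -- rewrite the summand on the block
      have hcongr : ∀ x ∈ block y, (if blockOf x ∈ Λ ∧ blockOf (x.shift μ) ∈ Λ then 1 else 0 : ℕ)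
          = if ((x μ).val % P.L + 1 = P.L) then (if y.shift μ ∈ Λ then 1 else 0) else 1 := by
        intro x hx
        have hxy : blockOf x = y := (mem_filter.1 hx).2
        rw [blockOf_shift hj, hxy]
        by_cases ht : (x μ).val % P.L + 1 = P.L
        · simp [ht, hy]
        · simp [ht, hy]
      rw [sum_congr rfl hcongr, ← sum_filter_add_sum_filter_not (block y) (fun x => (x μ).val % P.L + 1 = P.L)]
      have hA : ∑ x ∈ (block y).filter (fun x => (x μ).val % P.L + 1 = P.L),
          (if ((x μ).val % P.L + 1 = P.L) then (if y.shift μ ∈ Λ then 1 else 0) else 1 : ℕ)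
          = P.L ^ (P.d - 1) * (if y.shift μ ∈ Λ then 1 else 0) := by
        rw [sum_congr rfl (fun x hx => if_pos (mem_filter.1 hx).2), sum_const, smul_eq_mul,
          card_block_filter_top hj]
      have hB : ∑ x ∈ (block y).filter (fun x => ¬ ((x μ).val % P.L + 1 = P.L)),
          (if ((x μ).val % P.L + 1 = P.L) then (if y.shift μ ∈ Λ then 1 else 0) else 1 : ℕ)
          = P.L ^ P.d - P.L ^ (P.d - 1) := by
        rw [sum_congr rfl (fun x hx => if_neg (mem_filter.1 hx).2), sum_const, smul_eq_mul, mul_one,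
          card_block_filter_not_top hj]
      rw [hA, hB, add_comm]
    · rw [if_neg hy]
      refine sum_eq_zero (fun x hx => ?_)
      have hxy : blockOf x = y := (mem_filter.1 hx).2
      rw [hF]
      refine sum_eq_zero (fun μ _ => ?_)
      rw [hxy]; simp [hy]
  -- fiberwise regrouping over the blocks
  have h2 : ∑ x : Site P j, F x = ∑ y : Site P (j + 1), ∑ x ∈ block y, F x := by
    rw [← sum_fiberwise univ blockOf F]
    rfl
  rw [h1, h2, sum_congr rfl (fun y _ => hblock y), ← sum_filter, filter_mem_eq_inter, univ_inter]
  have h3 : ∑ y ∈ Λ, ∑ μ : Fin P.d, (if y.shift μ ∈ Λ then 1 else 0 : ℕ)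
      = ∑ y : Site P (j + 1), ∑ μ : Fin P.d, (if y ∈ Λ ∧ y.shift μ ∈ Λ then 1 else 0 : ℕ) := by
    rw [← sum_filter_add_sum_filter_not univ (fun y => y ∈ Λ), filter_mem_eq_inter, univ_inter]
    have hz : ∑ y ∈ univ.filter (fun y => ¬ y ∈ Λ), ∑ μ : Fin P.d,
        (if y ∈ Λ ∧ y.shift μ ∈ Λ then 1 else 0 : ℕ) = 0 :=
      sum_eq_zero (fun y hy => sum_eq_zero (fun μ _ => by simp [(mem_filter.1 hy).2]))
    rw [hz, add_zero]
    exact sum_congr rfl (fun y hy => sum_congr rfl (fun μ _ => by simp [hy]))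
  have h4 : ∀ y ∈ Λ, ∑ μ : Fin P.d, ((P.L ^ P.d - P.L ^ (P.d - 1)) + P.L ^ (P.d - 1) *
      (if y.shift μ ∈ Λ then 1 else 0 : ℕ))
      = P.d * (P.L ^ P.d - P.L ^ (P.d - 1)) + P.L ^ (P.d - 1) *
          ∑ μ : Fin P.d, (if y.shift μ ∈ Λ then 1 else 0 : ℕ) := by
    intro y _
    rw [sum_add_distrib, sum_const, card_univ, Fintype.card_fin, smul_eq_mul, ← mul_sum]
  rw [sum_congr rfl h4, sum_add_distrib, sum_const, smul_eq_mul, ← mul_sum, h3, ← card_bondsIn_eq_sum Λ]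
  ring

/-- The coarse bonds split three ways: inside `Λ`, leaving `Λ`, or starting outside `Λ`
(`#bonds(Λ) + #out(Λ) + d|Λᶜ| = d|T^{(i)}|`; elementary; the second of the three numbers of the printed `|Ω₁*|`
against its whole-lattice value). [cite: Balaban1985UV3, p.260 (after (18))] -/
theorem card_bondsIn_add {i : ℕ} (Λ : Finset (Site P i)) :
    (bondsIn Λ).card + outCount Λ + P.d * (Λᶜ).card = P.d * Fintype.card (Site P i) := by
  classical
  have hsplit := card_filter_add_card_filter_not (s := (univ : Finset (PBond P i)))
    (fun c => c.src ∈ Λ)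
  have hin := card_filter_add_card_filter_not
    (s := (univ : Finset (PBond P i)).filter (fun c => c.src ∈ Λ)) (fun c => c.tgt ∈ Λ)
  rw [filter_filter, filter_filter] at hin
  have hout : (univ.filter (fun c : PBond P i => ¬ c.src ∈ Λ)).card = P.d * (Λᶜ).card := by
    rw [card_filter, sum_pbond]
    have : ∀ x : Site P i, ∑ μ : Fin P.d, (if ¬ (⟨x, μ⟩ : PBond P i).src ∈ Λ then 1 else 0 : ℕ)
        = if x ∈ Λᶜ then P.d else 0 := by
      intro x
      by_cases hx : x ∈ Λ
      · simp [hx]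
      · simp [hx]
    rw [Fintype.sum_congr _ _ this, ← sum_filter, filter_mem_eq_inter, univ_inter, sum_const, smul_eq_mul,
      mul_comm]
  rw [card_univ, card_pbond] at hsplit
  unfold bondsIn outCount
  omega

/-- `#out(Λ) ≤ d|Λᶜ|`: a leaving bond is determined by its endpoint in `Λᶜ` and its direction (elementary; serves the
upper half of the count behind p. 265 / p. 271). [cite: Balaban1985UV3, p.265 + p.271] -/
theorem outCount_le {i : ℕ} (Λ : Finset (Site P i)) : outCount Λ ≤ P.d * (Λᶜ).card := by
  classical
  unfold outCount
  calc (univ.filter (fun c : PBond P i => c.src ∈ Λ ∧ c.tgt ∉ Λ)).card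
      ≤ (univ.filter (fun c : PBond P i => c.tgt ∉ Λ)).card :=
        card_le_card (fun c hc => by
          simp only [mem_filter, mem_univ, true_and] at hc ⊢; exact hc.2)
    _ = ∑ x : Site P i, ∑ μ : Fin P.d, (if x.shift μ ∉ Λ then 1 else 0 : ℕ) := by
        rw [card_filter, sum_pbond]; rfl
    _ = ∑ μ : Fin P.d, ∑ x : Site P i, (if x.shift μ ∉ Λ then 1 else 0 : ℕ) := sum_comm
    _ = ∑ μ : Fin P.d, ∑ x : Site P i, (if x ∉ Λ then 1 else 0 : ℕ) := by
        refine sum_congr rfl (fun μ _ => ?_)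
        exact Fintype.sum_equiv (shiftEquiv μ) _ _ (fun x => rfl)
    _ = P.d * (Λᶜ).card := by
        rw [← sum_filter_add_sum_filter_not univ (fun x : Site P i => x ∈ Λ)]
        have h0 : ∑ x ∈ univ.filter (fun x : Site P i => x ∈ Λ), (if x ∉ Λ then 1 else 0 : ℕ) = 0 :=
          sum_eq_zero (fun x hx => by simp [(mem_filter.1 hx).2])
        have h1 : ∑ x ∈ univ.filter (fun x : Site P i => ¬ x ∈ Λ), (if x ∉ Λ then 1 else 0 : ℕ)
            = (Λᶜ).card := by
          rw [sum_congr rfl (fun x hx => if_pos (mem_filter.1 hx).2), sum_const, smul_eq_mul, mul_one]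
          congr 1; ext x; simp
        rw [h0, h1, zero_add, sum_const, card_univ, Fintype.card_fin, smul_eq_mul]

end Counts

/-! ## §4 The star count: whole lattice, deficit, two-sided bound -/

section Star

/-- Cast bookkeeping: `L^{d−1} ≤ L^d`. [folklore] -/
private theorem pow_pred_le (P : Params) : P.L ^ (P.d - 1) ≤ P.L ^ P.d :=
  Nat.pow_le_pow_right P.L_pos (Nat.sub_le _ _)

/-- `L^d = L·L^{d−1}` (`d ≥ 1`). [folklore] -/
private theorem pow_eq_mul_pow_pred (P : Params) : P.L ^ P.d = P.L * P.L ^ (P.d - 1) := by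
  rw [← pow_succ']
  congr 1
  have := P.hd
  omega

/-- **`|T₁^{(k)*}| = (d − 1)(L^d − 1)·|T^{(k+1)}|`** — the whole-lattice star count (`Λ = T^{(k+1)}`, `B(Λ) = T₁^{(k)}`),
the quantity multiplying `log σ₀` and `d(𝔤)log g_k` in `E^{(k)}` of (36)/(62): per block, `dL^d` bonds, minus `d` coarse
bonds, minus `L^d − 1` axial conditions. [cite: Balaban1985UV3, (62) p.271] -/
theorem starCount_univ (hj : j + 1 ≤ P.m + P.K) :
    starCount (univ : Finset (Site P (j + 1)))
      = ((P.d : ℤ) - 1) * ((P.L : ℤ) ^ P.d - 1) * Fintype.card (Site P (j + 1)) := by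
  unfold starCount
  rw [card_bondsIn_blockSet hj, card_bondsIn_univ, axialCount_eq hj, card_univ]
  have h1 := pow_pred_le P
  have h2 : 1 ≤ P.L ^ P.d := Nat.one_le_pow _ _ P.L_pos
  have h3 : ((P.L : ℤ)) ^ P.d = (P.L : ℤ) * (P.L : ℤ) ^ (P.d - 1) := by exact_mod_cast pow_eq_mul_pow_pred P
  push_cast [Nat.cast_sub h1, Nat.cast_sub h2]
  rw [h3]
  ring

/-- The same in unit-lattice volume: **`L^d·|T₁^{(k)*}| = (d − 1)(L^d − 1)·|T₁^{(k)}|`**, i.e.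
`|T₁^{(k)*}| = (d − 1)(1 − L^{−d})|T₁^{(k)}|` (for d = 3: `2(1 − L⁻³)|T₁^{(k)}|`, between `(7/4)|T₁^{(k)}|` and
`2|T₁^{(k)}|`). [cite: Balaban1985UV3, (62) p.271] -/
theorem starCount_univ_fine (hj : j + 1 ≤ P.m + P.K) :
    ((P.L : ℤ) ^ P.d) * starCount (univ : Finset (Site P (j + 1)))
      = ((P.d : ℤ) - 1) * ((P.L : ℤ) ^ P.d - 1) * Fintype.card (Site P j) := by
  rw [starCount_univ hj, Site.card_site_eq_mul_succ hj]
  push_cast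
  ring

/-- **The deficit identity**: `|T₁^{(k)*}| − |B(Λ)*| = (d − 1)(L^d − 1)|Λᶜ| + (L^{d−1} − 1)·#out(Λ)`. [cite: Balaban1985UV3, p.265 + p.271] -/
theorem starCount_deficit_eq (hj : j + 1 ≤ P.m + P.K) (Λ : Finset (Site P (j + 1))) :
    starCount (univ : Finset (Site P (j + 1))) - starCount Λ
      = ((P.d : ℤ) - 1) * ((P.L : ℤ) ^ P.d - 1) * (Λᶜ).card + (((P.L : ℤ) ^ (P.d - 1)) - 1) * outCount Λ := by
  have hsplit := card_bondsIn_add Λ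
  have hcard : Λ.card + (Λᶜ).card = Fintype.card (Site P (j + 1)) := by
    rw [card_compl]; exact Nat.add_sub_of_le (card_le_univ Λ)
  unfold starCount
  rw [card_bondsIn_blockSet hj, card_bondsIn_blockSet hj, card_bondsIn_univ, axialCount_eq hj,
    axialCount_eq hj, card_univ]
  have h1 := pow_pred_le P
  have h2 : 1 ≤ P.L ^ P.d := Nat.one_le_pow _ _ P.L_pos
  have h3 : ((P.L : ℤ)) ^ P.d = (P.L : ℤ) * (P.L : ℤ) ^ (P.d - 1) := by exact_mod_cast pow_eq_mul_pow_pred P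
  have e1 : ((bondsIn Λ).card : ℤ) + (outCount Λ : ℤ) + (P.d : ℤ) * ((Λᶜ).card : ℤ)
      = (P.d : ℤ) * (Fintype.card (Site P (j + 1)) : ℤ) := by exact_mod_cast hsplit
  have e2 : (Λ.card : ℤ) + ((Λᶜ).card : ℤ) = (Fintype.card (Site P (j + 1)) : ℤ) := by exact_mod_cast hcard
  push_cast [Nat.cast_sub h1, Nat.cast_sub h2]
  rw [h3]
  linear_combination (1 - (P.L : ℤ) ^ (P.d - 1)) * e1
    + (((P.L : ℤ) * (P.L : ℤ) ^ (P.d - 1) - 1)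
        - (P.d : ℤ) * ((P.L : ℤ) * (P.L : ℤ) ^ (P.d - 1) - (P.L : ℤ) ^ (P.d - 1))) * e2

/-- **Lower half of the count**: `|B(Λ)*| ≤ |T₁^{(k)*|`, indeed the deficit is at least `(d − 1)(L^d − 1)|Λᶜ| ≥ 0`.
[cite: Balaban1985UV3, p.265 + p.271] -/
theorem starCount_deficit_nonneg (hj : j + 1 ≤ P.m + P.K) (Λ : Finset (Site P (j + 1))) :
    0 ≤ starCount (univ : Finset (Site P (j + 1))) - starCount Λ := by
  rw [starCount_deficit_eq hj]
  have hd : (1 : ℤ) ≤ P.d := by exact_mod_cast P.hd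
  have hL : (1 : ℤ) ≤ P.L := by exact_mod_cast P.L_pos
  have hLd : (1 : ℤ) ≤ (P.L : ℤ) ^ P.d := one_le_pow₀ hL
  have hLd' : (1 : ℤ) ≤ (P.L : ℤ) ^ (P.d - 1) := one_le_pow₀ hL
  have h1 : (0 : ℤ) ≤ ((P.d : ℤ) - 1) * ((P.L : ℤ) ^ P.d - 1) * (Λᶜ).card :=
    mul_nonneg (mul_nonneg (by linarith) (by linarith)) (by positivity)
  have h2 : (0 : ℤ) ≤ (((P.L : ℤ) ^ (P.d - 1)) - 1) * outCount Λ :=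
    mul_nonneg (by linarith) (by positivity)
  linarith

/-- `|B(Λ)*| ≤ |T₁^{(k)*}|`. [cite: Balaban1985UV3, p.265 + p.271] -/
theorem starCount_le_univ (hj : j + 1 ≤ P.m + P.K) (Λ : Finset (Site P (j + 1))) :
    starCount Λ ≤ starCount (univ : Finset (Site P (j + 1))) := by
  have := starCount_deficit_nonneg hj Λ; linarith

/-- **Upper half of the count**: `|T₁^{(k)*}| − |B(Λ)*| ≤ c⋆|Λᶜ|`, `c⋆ = (d − 1)(L^d − 1) + d(L^{d−1} − 1)` (integer
form). [cite: Balaban1985UV3, p.265 + p.271] -/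
theorem starCount_deficit_le (hj : j + 1 ≤ P.m + P.K) (Λ : Finset (Site P (j + 1))) :
    starCount (univ : Finset (Site P (j + 1))) - starCount Λ
      ≤ (((P.d : ℤ) - 1) * ((P.L : ℤ) ^ P.d - 1) + (P.d : ℤ) * (((P.L : ℤ) ^ (P.d - 1)) - 1)) * (Λᶜ).card := by
  rw [starCount_deficit_eq hj]
  have hL : (1 : ℤ) ≤ P.L := by exact_mod_cast P.L_pos
  have hLd' : (1 : ℤ) ≤ (P.L : ℤ) ^ (P.d - 1) := one_le_pow₀ hL
  have hout : (outCount Λ : ℤ) ≤ (P.d : ℤ) * ((Λᶜ).card : ℤ) := by exact_mod_cast outCount_le Λ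
  nlinarith

/-- **`|B(Λ)*| ≥ 0`**: the printed difference of three bond numbers is a genuine count — per block it is at least
`(d − 1)L^d − dL^{d−1} + 1 ≥ 0` (`L ≥ 2`). [cite: Balaban1985UV3, p.260 (after (18))] -/
theorem starCount_nonneg (hj : j + 1 ≤ P.m + P.K) (Λ : Finset (Site P (j + 1))) : 0 ≤ starCount Λ := by
  unfold starCount
  rw [card_bondsIn_blockSet hj, axialCount_eq hj]
  have h1 := pow_pred_le P
  have h2 : 1 ≤ P.L ^ P.d := Nat.one_le_pow _ _ P.L_pos
  have h3 : ((P.L : ℤ)) ^ P.d = (P.L : ℤ) * (P.L : ℤ) ^ (P.d - 1) := by exact_mod_cast pow_eq_mul_pow_pred P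
  have hL2 : (2 : ℤ) ≤ P.L := by have := P.hL.2; exact_mod_cast this
  have hd : (1 : ℤ) ≤ P.d := by exact_mod_cast P.hd
  set X : ℤ := (P.L : ℤ) ^ (P.d - 1) with hX
  have hX1 : (1 : ℤ) ≤ X := one_le_pow₀ (by linarith)
  have hX0 : (0 : ℤ) ≤ X := by linarith
  have hc : (0 : ℤ) ≤ (bondsIn Λ).card := by positivity
  have hΛ : (0 : ℤ) ≤ Λ.card := by positivity
  -- per-site coefficient `(d−1)·L·L^{d−1} − d·L^{d−1} + 1 ≥ 0` and `L^{d−1} − 1 ≥ 0`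
  have key : (0 : ℤ) ≤ ((P.d : ℤ) - 1) * (P.L : ℤ) * X - (P.d : ℤ) * X + 1 := by
    rcases Nat.lt_or_ge P.d 2 with hlt | hge
    · have hd1 : P.d = 1 := by have := P.hd; omega
      have hX' : X = 1 := by rw [hX, hd1]; simp
      rw [hX', hd1]; norm_num
    · have hd2 : (2 : ℤ) ≤ P.d := by exact_mod_cast hge
      have hA : (0 : ℤ) ≤ ((P.d : ℤ) - 1) * ((P.L : ℤ) - 2) * X :=
        mul_nonneg (mul_nonneg (by linarith) (by linarith)) hX0
      have hB : (0 : ℤ) ≤ ((P.d : ℤ) - 2) * X := mul_nonneg (by linarith) hX0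
      nlinarith [hA, hB]
  push_cast [Nat.cast_sub h1, Nat.cast_sub h2]
  rw [h3]
  nlinarith [mul_nonneg key hΛ, mul_nonneg (sub_nonneg.2 hX1) hc]

/-- Real form of the two-sided count with the unit-lattice volume `|Z| = |B(Λ)ᶜ| = L^d|Λᶜ|`:
`0 ≤ |T*| − |B(Λ)*| ≤ (c⋆/L^d)·|Z|`. [cite: Balaban1985UV3, p.265 + p.271] -/
theorem starCount_deficit_le_real (hj : j + 1 ≤ P.m + P.K) (Λ : Finset (Site P (j + 1))) :
    (0 : ℝ) ≤ (starCount (univ : Finset (Site P (j + 1))) : ℝ) - (starCount Λ : ℝ) ∧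
      (starCount (univ : Finset (Site P (j + 1))) : ℝ) - (starCount Λ : ℝ)
        ≤ cStar P / (P.L : ℝ) ^ P.d * (((blockSet Λ)ᶜ).card : ℝ) := by
  have hLpos : (0 : ℝ) < (P.L : ℝ) ^ P.d := by
    have : (0 : ℝ) < P.L := by exact_mod_cast P.L_pos
    positivity
  constructor
  · have := starCount_deficit_nonneg hj Λ
    exact_mod_cast this
  · have h := starCount_deficit_le hj Λ
    have h' : ((starCount (univ : Finset (Site P (j + 1))) - starCount Λ : ℤ) : ℝ)
        ≤ ((((P.d : ℤ) - 1) * ((P.L : ℤ) ^ P.d - 1) + (P.d : ℤ) * (((P.L : ℤ) ^ (P.d - 1)) - 1)) * (Λᶜ).card : ℤ) := by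
      exact_mod_cast h
    push_cast at h'
    rw [card_compl_blockSet hj]
    push_cast
    rw [cStar, div_mul_eq_mul_div, mul_comm ((P.L : ℝ) ^ P.d) ((Λᶜ).card : ℝ), ← mul_assoc,
      mul_div_assoc, div_self hLpos.ne', mul_one]
    exact h'

end Star

/-! ## §5 The leaf `B10SectAGathering.StarCount` BY NAME -/

section Leaf

open Literature.MathematicalPhysics.QuantumFieldTheory.Balaban1983to89.B10

/-- **The cell's leaf, discharged for the concrete counts.**  For any step pieces `S` (over any `TowerRun`) whose
whole-lattice star count `starT`, per-history star count `starB h` and complement volume `Zvol h` ARE the counts of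
this file for some assignment `h ↦ Λ h` of coarse regions `Λ_{k+1}` to histories, the leaf
`B10SectAGathering.StarCount S c₁` — *"0 ≤ |T₁^{(k)*}| − |B(Λ_{k+1})*| ≤ c₁|Z_k|"* — HOLDS with `c₁ = c⋆/L^d`.
[cite: Balaban1985UV3, p.265 + p.271] -/
theorem starCount_leaf {T : TowerRun} {k : ℕ} (S : B10SectAGathering.StepPieces T k)
    (hj : j + 1 ≤ P.m + P.K) (Λ : T.Hist (k + 1) → Finset (Site P (j + 1)))
    (hT : S.starT = (starCount (univ : Finset (Site P (j + 1))) : ℝ))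
    (hB : ∀ h, S.starB h = (starCount (Λ h) : ℝ))
    (hZ : ∀ h, S.Zvol h = (((blockSet (Λ h))ᶜ).card : ℝ)) :
    B10SectAGathering.StarCount S (cStar P / (P.L : ℝ) ^ P.d) := by
  intro h
  rw [hT, hB h, hZ h]
  exact starCount_deficit_le_real hj (Λ h)

/-- Consequently the cell's `constants_complement` — *"(log σ₀ + d(𝔤)log g_k)|B*| ≤ (log σ₀ + d(𝔤)log g_k)|T*| +
(|log σ₀| + d(𝔤)log g_k⁻¹)·c₁|Z_k|"*, where the printed `O(log g_k⁻¹)|Z_k|` of (36)/(41) is born — holds for such step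
pieces with NO counting hypothesis left (`0 < g_k ≤ 1` as there). [cite: Balaban1985UV3, (36) p.265 + (41) p.266] -/
theorem constants_complement_concrete {T : TowerRun} {k : ℕ} (S : B10SectAGathering.StepPieces T k)
    (hj : j + 1 ≤ P.m + P.K) (Λ : T.Hist (k + 1) → Finset (Site P (j + 1)))
    (hT : S.starT = (starCount (univ : Finset (Site P (j + 1))) : ℝ))
    (hB : ∀ h, S.starB h = (starCount (Λ h) : ℝ))
    (hZ : ∀ h, S.Zvol h = (((blockSet (Λ h))ᶜ).card : ℝ))
    (hg : 0 < T.g k) (hg1 : T.g k ≤ 1) (h : T.Hist (k + 1)) :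
    (S.logσ₀ + S.dg * Real.log (T.g k)) * S.starB h ≤
      (S.logσ₀ + S.dg * Real.log (T.g k)) * S.starT
        + (|S.logσ₀| + S.dg * Real.log (T.g k)⁻¹) * (cStar P / (P.L : ℝ) ^ P.d * S.Zvol h) :=
  B10SectAGathering.constants_complement S hg hg1 (starCount_leaf S hj Λ hT hB hZ) h

end Leaf

/-! ## §6 The paper's case d = 3 (Theorem 1 p. 257) -/

section DimThree

/-- At `d = 3`: `c⋆ = 2(L³ − 1) + 3(L² − 1) = 2L³ + 3L² − 5`. [cite: Balaban1985UV3, Theorem 1 p.257] -/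
theorem cStar_d3 (hd : P.d = 3) : cStar P = 2 * (P.L : ℝ) ^ 3 + 3 * (P.L : ℝ) ^ 2 - 5 := by
  rw [cStar, hd]
  norm_num
  ring

/-- At `d = 3` the per-unit-site constant is `c₁ = c⋆/L³ < 3` (indeed `→ 2` as `L → ∞`; `L ≥ 2`). [cite: Balaban1985UV3, Theorem 1 p.257] -/
theorem cStar_div_lt_three (hd : P.d = 3) : cStar P / (P.L : ℝ) ^ P.d < 3 := by
  rw [cStar_d3 hd, hd]
  have hL : (2 : ℝ) ≤ P.L := by have := P.hL.2; exact_mod_cast this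
  have hL3 : (0 : ℝ) < (P.L : ℝ) ^ 3 := by positivity
  rw [div_lt_iff₀ hL3]
  nlinarith [mul_nonneg (sub_nonneg.2 hL) (sub_nonneg.2 hL), mul_nonneg (mul_nonneg (sub_nonneg.2 hL)
    (sub_nonneg.2 hL)) (sub_nonneg.2 hL)]

/-- At `d = 3`: **`|T₁^{(k)*}| = 2(L³ − 1)|T^{(k+1)}|`** (= `2(1 − L⁻³)|T₁^{(k)}|`). [cite: Balaban1985UV3, (62) p.271] -/
theorem starCount_univ_d3 (hd : P.d = 3) (hj : j + 1 ≤ P.m + P.K) :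
    starCount (univ : Finset (Site P (j + 1))) = 2 * ((P.L : ℤ) ^ 3 - 1) * Fintype.card (Site P (j + 1)) := by
  rw [starCount_univ hj, hd]
  push_cast
  ring

/-- At `d = 3`, in unit-lattice volume: `0 ≤ |T₁^{(k)*}| − |B(Λ_{k+1})*| < 3|Z_k|` whenever `Z_k ≠ ∅` (and `= 0` at the
trivial history `Λ_{k+1} = T^{(k+1)}`, `Z_k = ∅`). [cite: Balaban1985UV3, p.265 + p.271] -/
theorem starCount_deficit_d3 (hd : P.d = 3) (hj : j + 1 ≤ P.m + P.K) (Λ : Finset (Site P (j + 1))) :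
    (0 : ℝ) ≤ (starCount (univ : Finset (Site P (j + 1))) : ℝ) - (starCount Λ : ℝ) ∧
      (starCount (univ : Finset (Site P (j + 1))) : ℝ) - (starCount Λ : ℝ)
        ≤ 3 * (((blockSet Λ)ᶜ).card : ℝ) := by
  obtain ⟨h0, h1⟩ := starCount_deficit_le_real hj Λ
  refine ⟨h0, h1.trans ?_⟩
  exact mul_le_mul_of_nonneg_right (cStar_div_lt_three hd).le (by positivity)

end DimThree

end Literature.MathematicalPhysics.QuantumFieldTheory.Balaban1983to89.B10StarCount
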